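import Literature.Geometry.Lorentzian.DataFamilyTangentKernelManifold
import Literature.Geometry.Lorentzian.ChartBilinPullback
import HarnessLib

/-!
# Local deformations of the constraints, read in a chart: coordinate data and witnessed tangents

Topic `Literature/Geometry/Lorentzian`. Everything here is PROVED; no definition, no statement of
`Prop` type is introduced.

This file and `LocalConstraintDeformationReassembly.lean` are the bookkeeping of the assembly of
the named fact `ChruscielDelay_localConstraintDeformation` (`LocalConstraintDeformation.lean`;
Chruściel–Delay 2003, Thm. 5.9 / Prop. 5.10 / Cor. 5.11) that isolates its analytic cores as
statements about COORDINATE fields on a ball of `E3`: here the passage FROM the manifold TO the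
chart. Let `X` be a `3`-manifold, `D = (h, k)` an initial data set
on `X`, `x₀ ∈ X`, `c = chartAt E3 x₀` with target `𝓣` (an `Opens E3`) and inverse chart
`Φ : 𝓣 → X`, and `B̄ = closedBall (c x₀) ρ ⊆ 𝓣`.

* `InitialDataSet.exists_chart_closedBall_subset` — small closed coordinate balls around `c x₀`
  lie in the chart target and are carried by `Φ` into any given neighbourhood of `x₀`;
* `InitialDataSet.coordVacuum_comap_chart` (and `isMetricOn_coordHOn`, `contDiffOn_coordKOn'`,
  `coordHOn_pos`) — the coordinate readings `(G, K) = (coordHOn, coordKOn)` of `Φ^* D` are smooth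
  coordinate data on `𝓣`, `G` Riemannian, solving `hamAt G K = 0`, `momFn G K = 0` on `𝓣` when
  `D` is vacuum (bridge `OpensChart.hamiltonianConstraintFn_eq_hamAt` + naturality
  `isVacuumAt_comap_iff`);
* `InitialDataSet.exists_chartWitness` — **the witnessed tangents `(a, b)` of the fact, read in the
  chart, are smooth symmetric compactly supported kernel elements `(γ, κ)` of the coordinate
  linearised constraint map `DΦ_{(G,K)}`** on `𝓣` (`DataFamilyTangentKernelManifold.lean`), with
  `c^* γ = a`, `c^* κ = b` on the chart source;
* the converse transport — coordinate deformation families on `𝓣` back to vacuum data on `X` —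
  is `InitialDataSet.exists_localFamily_of_coordFamily` of
  `LocalConstraintDeformationReassembly.lean`.

The two analytic cores — "no local space-time Killing fields ⇒ no coordinate KIDs on small balls"
(Moncrief 1975) and "coordinate vacuum data without KIDs on `B` admit such coordinate families
with prescribed compactly supported kernel tangents" (Chruściel–Delay 2003, §5; weighted spaces,
the isomorphism `PΦ²ψ²P*`, regularity up to `∂B`) — are what remains; see
`LocalConstraintDeformationReduction.lean`.

## References

* P. T. Chruściel, E. Delay, Mém. Soc. Math. Fr. 94 (2003), Thm. 5.9, Prop. 5.10, Cor. 5.11.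
  [ChruscielDelay2003]
* R. Bartnik, J. Isenberg, *The constraint equations* (2004), §2. [BartnikIsenberg2004]
* J. Corvino, Comm. Math. Phys. 214 (2000), §4. [Corvino2000]
-/

noncomputable section

set_option maxSynthPendingDepth 3

open Bundle Set Function Filter TopologicalSpace Manifold Module Metric
open scoped Manifold ContDiff Topology

namespace Literature.Geometry.Lorentzian

namespace InitialDataSet

variable {X : Type*} [TopologicalSpace X] [ChartedSpace E3 X] [IsManifold (𝓡 3) ∞ X]

/-! ### Small coordinate balls -/

omit [IsManifold (𝓡 3) ∞ X] in
/-- **Small closed coordinate balls**: for `V` an open neighbourhood of `x₀` and `ρ₀ > 0` there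
is `0 < ρ ≤ ρ₀` with `closedBall (c x₀) ρ ⊆ c.target` and `c.symm '' closedBall (c x₀) ρ ⊆ V`
(`c = chartAt E3 x₀`). [folklore] -/
theorem exists_chart_closedBall_subset (x₀ : X) {V : Set X} (hV : IsOpen V) (hx₀ : x₀ ∈ V)
    {ρ₀ : ℝ} (hρ₀ : 0 < ρ₀) :
    ∃ ρ : ℝ, 0 < ρ ∧ ρ ≤ ρ₀ ∧ closedBall (chartAt E3 x₀ x₀) ρ ⊆ (chartAt E3 x₀).target ∧
      (chartAt E3 x₀).symm '' closedBall (chartAt E3 x₀ x₀) ρ ⊆ V := by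
  have hT : (chartAt E3 x₀).target ∩ (chartAt E3 x₀).symm ⁻¹' V ∈ 𝓝 (chartAt E3 x₀ x₀) := by
    refine ((chartAt E3 x₀).isOpen_inter_preimage_symm hV).mem_nhds ⟨mem_chart_target E3 x₀, ?_⟩
    show (chartAt E3 x₀).symm (chartAt E3 x₀ x₀) ∈ V
    rw [(chartAt E3 x₀).left_inv (mem_chart_source E3 x₀)]
    exact hx₀
  obtain ⟨ρ', hρ', hsub⟩ := nhds_basis_closedBall.mem_iff.1 hT
  refine ⟨min ρ' ρ₀, lt_min hρ' hρ₀, min_le_right _ _, fun z hz ↦ (hsub ?_).1, ?_⟩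
  · exact closedBall_subset_closedBall (min_le_left _ _) hz
  · rintro _ ⟨z, hz, rfl⟩
    exact (hsub (closedBall_subset_closedBall (min_le_left _ _) hz)).2

/-! ### The coordinate readings of `Φ^* D` on the chart target -/

section Readings

variable {U : Opens E3} (D' : InitialDataSet 𝓘(ℝ, E3) U)

/-- The reading `coordHOn` of data on a chart domain is a smooth symmetric nondegenerate field
on the domain (`MetricCoord.IsMetricOn`). [folklore] -/
theorem isMetricOn_coordHOn : MetricCoord.IsMetricOn D'.coordHOn (U : Set E3) :=
  OpensChart.isMetricOn_repr (metric_val_eq_coordHOn D')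

/-- The reading `coordKOn` is `C^∞` on the domain. [folklore] -/
theorem contDiffOn_coordKOn' : ContDiffOn ℝ ∞ D'.coordKOn (U : Set E3) := fun z hz ↦
  (OpensChart.contDiffAt_reprK (k_eq_coordKOn D') ⟨z, hz⟩).contDiffWithinAt

/-- The reading `coordHOn` is positive definite on the domain. [folklore] -/
theorem coordHOn_pos {z : E3} (hz : z ∈ U) (v : E3) (hv : v ≠ 0) : 0 < D'.coordHOn z v v := by
  rw [coordHOn_of_mem _ hz]
  exact D'.h.pos ⟨z, hz⟩ v hv

/-- The reading `coordHOn` is symmetric (everywhere; it is `0` off the domain). [folklore] -/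
theorem coordHOn_symm (z v w : E3) : D'.coordHOn z v w = D'.coordHOn z w v := by
  by_cases hz : z ∈ U
  · rw [coordHOn_of_mem _ hz]
    exact D'.h.symm ⟨z, hz⟩ v w
  · rw [coordHOn_of_not_mem _ hz]
    rfl

/-- The reading `coordKOn` is symmetric. [folklore] -/
theorem coordKOn_symm (z v w : E3) : D'.coordKOn z v w = D'.coordKOn z w v := by
  by_cases hz : z ∈ U
  · rw [coordKOn_of_mem _ hz]
    exact D'.k_symm ⟨z, hz⟩ v w
  · have h : D'.coordKOn z = 0 := by simp [coordKOn, hz]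
    rw [h]
    rfl

/-- **Vacuum data on a chart domain solve the coordinate vacuum constraints**:
`hamAt G K = 0`, `momFn G K = 0` on `U` for the readings `(G, K)` of a vacuum datum on `U`
(the bridge `OpensChart.hamiltonianConstraintFn_eq_hamAt`, `momentumConstraintFn_eq_momFn`).
[cite: BartnikIsenberg2004, (2.1)–(2.2)] -/
theorem coordVacuum_of_isVacuum [D'.metric.HasLeviCivita] (hvac : D'.IsVacuumConstraintSolution)
    {ι : Type*} [Fintype ι] (b₀ : Basis ι ℝ E3) {z : E3} (hz : z ∈ U) :
    MetricCoord.hamAt D'.coordHOn D'.coordKOn z = 0 ∧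
      ∀ Z : E3, MetricCoord.momFn b₀ D'.coordHOn D'.coordKOn z Z = 0 := by
  obtain ⟨hH, hM⟩ := hvac ⟨z, hz⟩
  refine ⟨?_, fun Z ↦ ?_⟩
  · rw [← OpensChart.hamiltonianConstraintFn_eq_hamAt (metric_val_eq_coordHOn D')
      (k_eq_coordKOn D') ⟨z, hz⟩]
    exact hH
  · rw [← OpensChart.momentumConstraintFn_eq_momFn (metric_val_eq_coordHOn D')
      (k_eq_coordKOn D') b₀ ⟨z, hz⟩ Z, hM]
    rfl

end Readings

/-- **The chart reading of vacuum data is coordinate-vacuum on the chart target**: for `D`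
vacuum on `X`, the readings of `Φ^* D` (`Φ` the inverse chart at `x₀`) solve `hamAt = 0`,
`momFn = 0` on `c.target` (naturality `isVacuumAt_comap_iff` and the bridge).
[cite: BartnikIsenberg2004, §2] -/
theorem coordVacuum_comap_chart (x₀ : X) (D : InitialDataSet (𝓡 3) X)
    (hvac : ∀ [D.metric.HasLeviCivita], D.IsVacuumConstraintSolution)
    {ι : Type*} [Fintype ι] (b₀ : Basis ι ℝ E3) {z : E3} (hz : z ∈ (chartAt E3 x₀).target) :
    MetricCoord.hamAt
        (D.comap _ (ChartInverse.contMDiff_symm x₀) (ChartInverse.injective_mfderiv_symm x₀)).coordHOn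
        (D.comap _ (ChartInverse.contMDiff_symm x₀) (ChartInverse.injective_mfderiv_symm x₀)).coordKOn
        z = 0 ∧
      ∀ Z : E3, MetricCoord.momFn b₀
        (D.comap _ (ChartInverse.contMDiff_symm x₀) (ChartInverse.injective_mfderiv_symm x₀)).coordHOn
        (D.comap _ (ChartInverse.contMDiff_symm x₀) (ChartInverse.injective_mfderiv_symm x₀)).coordKOn
        z Z = 0 := by
  set D' := D.comap _ (ChartInverse.contMDiff_symm x₀) (ChartInverse.injective_mfderiv_symm x₀)
    with hD'
  haveI := D.metric.hasLeviCivita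
  haveI := D'.metric.hasLeviCivita
  have hvac' : D'.IsVacuumConstraintSolution := fun u ↦
    (isVacuumAt_comap_iff D (ChartInverse.contMDiff_symm x₀)
      (ChartInverse.injective_mfderiv_symm x₀) u).2 (hvac _)
  exact coordVacuum_of_isVacuum D' hvac' b₀ hz

/-! ### The witnessed tangents, read in the chart -/

/-- Sections of `Φ^* D` only see the sections of `D` at `Φ u`. [folklore] -/
theorem comap_h_inner_congr {N : Type*} [TopologicalSpace N] [ChartedSpace E3 N]
    [IsManifold (𝓡 3) ∞ N] {D₁ D₂ : InitialDataSet (𝓡 3) X} {Φ : N → X}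
    (hΦ : ContMDiff (𝓡 3) (𝓡 3) (∞ + 1) Φ) (hΦ' : ∀ u, Injective (mfderiv (𝓡 3) (𝓡 3) Φ u))
    {u : N} (h : D₁.h.inner (Φ u) = D₂.h.inner (Φ u)) :
    (D₁.comap Φ hΦ hΦ').h.inner u = (D₂.comap Φ hΦ hΦ').h.inner u := by
  ext v w
  rw [comap_h_inner, comap_h_inner, h]

/-- Tensors `k` of `Φ^* D` only see `k` at `Φ u`. [folklore] -/
theorem comap_k_congr {N : Type*} [TopologicalSpace N] [ChartedSpace E3 N]
    [IsManifold (𝓡 3) ∞ N] {D₁ D₂ : InitialDataSet (𝓡 3) X} {Φ : N → X}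
    (hΦ : ContMDiff (𝓡 3) (𝓡 3) (∞ + 1) Φ) (hΦ' : ∀ u, Injective (mfderiv (𝓡 3) (𝓡 3) Φ u))
    {u : N} (h : D₁.k (Φ u) = D₂.k (Φ u)) :
    (D₁.comap Φ hΦ hΦ').k u = (D₂.comap Φ hΦ hΦ').k u := by
  ext v w
  rw [comap_k, comap_k, h]

/-- **The witnessed tangents of the fact, read in the chart at `x₀`, are smooth symmetric
compactly supported kernel elements of the coordinate linearised constraint map.** Let `(a, b)`
be witnessed as in `ChruscielDelay_localConstraintDeformation` (a jointly smooth one-parameter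
family `F` through `D`, equal to `D` off `K`, with fibrewise `s`-derivatives `(a, b)` at `s = 0`
and stationary constraint functions). Then there are fields `(γ, κ)` on `E3`, `C^∞` on the chart
target, symmetric, vanishing at every `z` with `z ∉ c.target` or `c.symm z ∉ K`, in the kernel of
`DΦ_{(G,K)}` on the target (`(G, K)` the readings of `Φ^* D`), and with `c^* γ = a`, `c^* κ = b`
on the chart source; moreover `a = b = 0` off `K`. (Chruściel–Delay 2003, §2: "`(bⱼ, aⱼ) ∈ ker P`,
smooth, supported in `K`", in coordinates.) [cite: ChruscielDelay2003, §2] -/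
theorem exists_chartWitness (x₀ : X) (D : InitialDataSet (𝓡 3) X) (K : Set X)
    (a bb : Π x : X, TangentSpace (𝓡 3) x →L[ℝ] TangentSpace (𝓡 3) x →L[ℝ] ℝ)
    (hw : ∃ F : EuclideanSpace ℝ (Fin 1) → InitialDataSet (𝓡 3) X,
      IsSmoothDataFamily 1 F ∧ F 0 = D ∧
      (∀ (c : EuclideanSpace ℝ (Fin 1)) (x : X), x ∉ K →
        (F c).h.inner x = D.h.inner x ∧ (F c).k x = D.k x) ∧
      (fun x : X ↦ deriv (fun s : ℝ ↦ (show E3 →L[ℝ] E3 →L[ℝ] ℝ from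
        (F (EuclideanSpace.single 0 s)).h.inner x)) 0) = a ∧
      (fun x : X ↦ deriv (fun s : ℝ ↦ (show E3 →L[ℝ] E3 →L[ℝ] ℝ from
        (F (EuclideanSpace.single 0 s)).k x)) 0) = bb ∧
      ∀ x : X,
        HasDerivAt (fun s : ℝ ↦
          haveI := (F (EuclideanSpace.single 0 s)).metric.hasLeviCivita
          (F (EuclideanSpace.single 0 s)).hamiltonianConstraintFn x) 0 0 ∧
        ∀ v : TangentSpace (𝓡 3) x,
          HasDerivAt (fun s : ℝ ↦
            haveI := (F (EuclideanSpace.single 0 s)).metric.hasLeviCivita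
            (F (EuclideanSpace.single 0 s)).momentumConstraintFn x v) 0 0)
    {ι : Type*} [Fintype ι] (b₀ : Basis ι ℝ E3) :
    ∃ γ κ : E3 → E3 →L[ℝ] E3 →L[ℝ] ℝ,
      ContDiffOn ℝ ∞ γ (chartAt E3 x₀).target ∧ ContDiffOn ℝ ∞ κ (chartAt E3 x₀).target ∧
      (∀ z v w, γ z v w = γ z w v) ∧ (∀ z v w, κ z v w = κ z w v) ∧
      (∀ z : E3, (∀ hz : z ∈ (chartAt E3 x₀).target, (chartAt E3 x₀).symm z ∉ K) →
        γ z = 0 ∧ κ z = 0) ∧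
      (∀ z ∈ (chartAt E3 x₀).target,
        MetricCoord.linHamFn b₀
          (D.comap _ (ChartInverse.contMDiff_symm x₀) (ChartInverse.injective_mfderiv_symm x₀)).coordHOn
          (D.comap _ (ChartInverse.contMDiff_symm x₀) (ChartInverse.injective_mfderiv_symm x₀)).coordKOn
          γ κ z = 0 ∧
        ∀ Z : E3, MetricCoord.linMomFn b₀
          (D.comap _ (ChartInverse.contMDiff_symm x₀) (ChartInverse.injective_mfderiv_symm x₀)).coordHOn
          (D.comap _ (ChartInverse.contMDiff_symm x₀) (ChartInverse.injective_mfderiv_symm x₀)).coordKOn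
          γ κ z Z = 0) ∧
      (∀ p ∈ (chartAt E3 x₀).source,
        pullbackBilin (I := 𝓘(ℝ, E3)) (I' := 𝓡 3) (chartAt E3 x₀) γ p = a p ∧
        pullbackBilin (I := 𝓘(ℝ, E3)) (I' := 𝓡 3) (chartAt E3 x₀) κ p = bb p) ∧
      (∀ p : X, p ∉ K → a p = 0 ∧ bb p = 0) := by
  obtain ⟨F, hF, hF0, hoff, ha, hb, hstat⟩ := hw
  subst hF0 ha hb
  set hΦ := ChartInverse.contMDiff_symm x₀ with hΦdef
  set hΦ' := ChartInverse.injective_mfderiv_symm x₀ with hΦ'def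
  -- the comapped family on the chart target and its variations
  set F' : EuclideanSpace ℝ (Fin 1) →
      InitialDataSet 𝓘(ℝ, E3) (⟨(chartAt E3 x₀).target, (chartAt E3 x₀).open_target⟩ : Opens E3) :=
    fun c ↦ (F c).comap _ hΦ hΦ' with hF'def
  have hF' : IsSmoothDataFamily 1 F' := hF.comap hΦ hΦ'
  set γ : E3 → E3 →L[ℝ] E3 →L[ℝ] ℝ :=
    MetricCoord.tDeriv (fun s z ↦ (F' (EuclideanSpace.single 0 s)).coordHOn z) univ 0 with hγ
  set κ : E3 → E3 →L[ℝ] E3 →L[ℝ] ℝ :=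
    MetricCoord.tDeriv (fun s z ↦ (F' (EuclideanSpace.single 0 s)).coordKOn z) univ 0 with hκ
  -- `a`, `bb` vanish off `K`
  have ha0 : ∀ p : X, p ∉ K →
      deriv (fun s : ℝ ↦ (show E3 →L[ℝ] E3 →L[ℝ] ℝ from
        (F (EuclideanSpace.single 0 s)).h.inner p)) 0 = 0 ∧
      deriv (fun s : ℝ ↦ (show E3 →L[ℝ] E3 →L[ℝ] ℝ from
        (F (EuclideanSpace.single 0 s)).k p)) 0 = 0 := by
    intro p hp
    constructor
    · have h : (fun s : ℝ ↦ (show E3 →L[ℝ] E3 →L[ℝ] ℝ from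
          (F (EuclideanSpace.single 0 s)).h.inner p)) = fun _ ↦
          (show E3 →L[ℝ] E3 →L[ℝ] ℝ from (F 0).h.inner p) := funext fun s ↦ (hoff _ p hp).1
      rw [h, deriv_const]
    · have h : (fun s : ℝ ↦ (show E3 →L[ℝ] E3 →L[ℝ] ℝ from
          (F (EuclideanSpace.single 0 s)).k p)) = fun _ ↦
          (show E3 →L[ℝ] E3 →L[ℝ] ℝ from (F 0).k p) := funext fun s ↦ (hoff _ p hp).2
      rw [h, deriv_const]
  refine ⟨γ, κ, contDiffOn_tDeriv_coordHOn_line F' hF', contDiffOn_tDeriv_coordKOn_line F' hF',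
    ?_, ?_, ?_, ?_, ?_, ha0⟩
  · -- symmetry of `γ`
    intro z v w
    exact derivWithin_symm_of_symm (B := fun s ↦ (F' (EuclideanSpace.single 0 s)).coordHOn z)
      (fun s v w ↦ coordHOn_symm _ z v w) v w
  · intro z v w
    exact derivWithin_symm_of_symm (B := fun s ↦ (F' (EuclideanSpace.single 0 s)).coordKOn z)
      (fun s v w ↦ coordKOn_symm _ z v w) v w
  · -- support
    intro z hz
    by_cases hzT : z ∈ (chartAt E3 x₀).target
    · have hK : (chartAt E3 x₀).symm z ∉ K := hz hzT
      constructor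
      · simp only [hγ, MetricCoord.tDeriv, derivWithin_univ]
        have h : (fun s : ℝ ↦ (F' (EuclideanSpace.single 0 s)).coordHOn z) =
            fun _ ↦ (F' 0).coordHOn z := by
          funext s
          rw [coordHOn_of_mem _ hzT, coordHOn_of_mem _ hzT]
          exact congrArg (fun B : TangentSpace 𝓘(ℝ, E3) (⟨z, hzT⟩ :
              (⟨(chartAt E3 x₀).target, (chartAt E3 x₀).open_target⟩ : Opens E3)) →L[ℝ]
              TangentSpace 𝓘(ℝ, E3) (⟨z, hzT⟩ :
              (⟨(chartAt E3 x₀).target, (chartAt E3 x₀).open_target⟩ : Opens E3)) →L[ℝ] ℝ ↦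
              (show E3 →L[ℝ] E3 →L[ℝ] ℝ from B))
            (comap_h_inner_congr hΦ hΦ' (hoff _ _ hK).1)
        rw [h, deriv_const]
      · simp only [hκ, MetricCoord.tDeriv, derivWithin_univ]
        have h : (fun s : ℝ ↦ (F' (EuclideanSpace.single 0 s)).coordKOn z) =
            fun _ ↦ (F' 0).coordKOn z := by
          funext s
          rw [coordKOn_of_mem _ hzT, coordKOn_of_mem _ hzT]
          exact congrArg (fun B : TangentSpace 𝓘(ℝ, E3) (⟨z, hzT⟩ :
              (⟨(chartAt E3 x₀).target, (chartAt E3 x₀).open_target⟩ : Opens E3)) →L[ℝ]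
              TangentSpace 𝓘(ℝ, E3) (⟨z, hzT⟩ :
              (⟨(chartAt E3 x₀).target, (chartAt E3 x₀).open_target⟩ : Opens E3)) →L[ℝ] ℝ ↦
              (show E3 →L[ℝ] E3 →L[ℝ] ℝ from B))
            (comap_k_congr hΦ hΦ' (hoff _ _ hK).2)
        rw [h, deriv_const]
    · constructor
      · simp only [hγ, MetricCoord.tDeriv, derivWithin_univ]
        have h : (fun s : ℝ ↦ (F' (EuclideanSpace.single 0 s)).coordHOn z) = fun _ ↦ 0 :=
          funext fun s ↦ coordHOn_of_not_mem _ hzT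
        rw [h, deriv_const]
      · simp only [hκ, MetricCoord.tDeriv, derivWithin_univ]
        have h : (fun s : ℝ ↦ (F' (EuclideanSpace.single 0 s)).coordKOn z) = fun _ ↦ 0 :=
          funext fun s ↦ by simp [coordKOn, hzT]
        rw [h, deriv_const]
  · -- kernel
    intro z hz
    have h := linConstraint_comapTangent_eq_zero F hF hΦ hΦ' b₀ ⟨z, hz⟩ (hstat _).1 (hstat _).2
    exact h
  · -- identification with `(a, b)` on the chart source
    intro p hp
    have hcp : chartAt E3 x₀ p ∈ (chartAt E3 x₀).target := (chartAt E3 x₀).map_source hp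
    have hpu : (chartAt E3 x₀).symm (chartAt E3 x₀ p) = p := (chartAt E3 x₀).left_inv hp
    have happ : ∀ (T : E3 →L[ℝ] E3) (B : E3 →L[ℝ] E3 →L[ℝ] ℝ) (v w : E3),
        ((ContinuousLinearMap.precomp ℝ T).comp (B.comp T)) v w = B (T v) (T w) :=
      fun _ _ _ _ ↦ rfl
    constructor
    · have h1 : γ (chartAt E3 x₀ p) = deriv (fun s : ℝ ↦ (show E3 →L[ℝ] E3 →L[ℝ] ℝ from
          (F' (EuclideanSpace.single 0 s)).h.inner ⟨chartAt E3 x₀ p, hcp⟩)) 0 :=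
        tDeriv_coordHOn_line_eq F' ⟨chartAt E3 x₀ p, hcp⟩
      have h2 := deriv_comap_h_inner_line F hF hΦ hΦ'
        (⟨chartAt E3 x₀ p, hcp⟩ : (⟨(chartAt E3 x₀).target, (chartAt E3 x₀).open_target⟩ : Opens E3))
      ext v w
      rw [pullbackBilin_apply, h1, h2]
      erw [happ]
      exact (congrArg₂ (fun y z : E3 ↦ deriv (fun s : ℝ ↦ (show E3 →L[ℝ] E3 →L[ℝ] ℝ from
          (F (EuclideanSpace.single 0 s)).h.inner ((chartAt E3 x₀).symm (chartAt E3 x₀ p)))) 0 y z)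
          (ChartInverse.mfderiv_symm_mfderiv_chart_apply x₀ hp v)
          (ChartInverse.mfderiv_symm_mfderiv_chart_apply x₀ hp w)).trans
        (congrArg (fun q : X ↦ deriv (fun s : ℝ ↦ (show E3 →L[ℝ] E3 →L[ℝ] ℝ from
          (F (EuclideanSpace.single 0 s)).h.inner q)) 0 v w) hpu)
    · have h1 : κ (chartAt E3 x₀ p) = deriv (fun s : ℝ ↦ (show E3 →L[ℝ] E3 →L[ℝ] ℝ from
          (F' (EuclideanSpace.single 0 s)).k ⟨chartAt E3 x₀ p, hcp⟩)) 0 :=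
        tDeriv_coordKOn_line_eq F' ⟨chartAt E3 x₀ p, hcp⟩
      have h2 := deriv_comap_k_line F hF hΦ hΦ'
        (⟨chartAt E3 x₀ p, hcp⟩ : (⟨(chartAt E3 x₀).target, (chartAt E3 x₀).open_target⟩ : Opens E3))
      ext v w
      rw [pullbackBilin_apply, h1, h2]
      erw [happ]
      exact (congrArg₂ (fun y z : E3 ↦ deriv (fun s : ℝ ↦ (show E3 →L[ℝ] E3 →L[ℝ] ℝ from
          (F (EuclideanSpace.single 0 s)).k ((chartAt E3 x₀).symm (chartAt E3 x₀ p)))) 0 y z)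
          (ChartInverse.mfderiv_symm_mfderiv_chart_apply x₀ hp v)
          (ChartInverse.mfderiv_symm_mfderiv_chart_apply x₀ hp w)).trans
        (congrArg (fun q : X ↦ deriv (fun s : ℝ ↦ (show E3 →L[ℝ] E3 →L[ℝ] ℝ from
          (F (EuclideanSpace.single 0 s)).k q)) 0 v w) hpu)

end InitialDataSet

end Literature.Geometry.Lorentzian

end
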